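import Summits.QuantumAdvantage.QuantumAdvantage.Theorems.StabilizerDialAntipodalB

/-! # StabilizerDialAntipodalC — part 3/5 (mechanical split for landing of `StabilizerDialAntipodal`; content verbatim; scopes re-opened with their variables) -/

set_option linter.dupNamespace false
noncomputable section
open scoped Classical

namespace Summit.QuantumAdvantage.QuantumAdvantage.Theorems.StabilizerDial
open Finset
open Literature.Computability.QuantumComplexity Literature.Computability.QuantumComplexity.RingHLF
open Literature.Computability.MetaComplexity Literature.Computability.MetaComplexity.Smolensky
open Summit.QuantumAdvantage.AdviceFreeQNC0
open Summit.QuantumAdvantage.QuantumAdvantage.Theorems.HolonomyDial (selP selP_mem selP_apply xorP xorP_mem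
  xorP_apply_bool tPoly tPoly_mem tPoly_apply mono_singleton_apply card_odd_le)
open Summit.QuantumAdvantage.QuantumAdvantage.Theorems.AnchorDial (outB dev card_odd_ge)
open Summit.QuantumAdvantage.QuantumAdvantage.Theorems.LocusDial (Coverable FewLocus)
variable {N : ℕ}

/-- **SUB-CUBE HOMOGENEITY**: a predicate ignoring the coordinates in `R` has `2^{|R|}` times its count on any `R`-sub-cube. -/
theorem card_filter_subcube (R : Finset (Fin N)) (w : Fin N → Bool) (P : (Fin N → Bool) → Prop) [DecidablePred P]
    (hP : ∀ x i b, i ∈ R → P x → P (Function.update x i b)) :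
    (univ.filter P).card = 2 ^ R.card * (univ.filter fun x => (∀ i ∈ R, x i = w i) ∧ P x).card := by
  induction R using Finset.induction_on generalizing P with
  | empty => simp
  | @insert i R hi ih =>
    rw [ih P (fun x j b hj => hP x j b (Finset.mem_insert_of_mem hj)), Finset.card_insert_of_notMem hi, pow_succ,
      mul_assoc]
    congr 1
    rw [card_filter_update_inv i (w i) (fun x => (∀ j ∈ R, x j = w j) ∧ P x) ?_]
    · congr 2; ext x; simp only [mem_filter, mem_univ, true_and, Finset.forall_mem_insert]; tauto
    · rintro x b ⟨h1, h2⟩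
      exact ⟨fun j hj => by rw [Function.update_apply, if_neg (by rintro rfl; exact hi hj)]; exact h1 j hj,
        hP x i b (Finset.mem_insert_self _ _) h2⟩

/-- an `R`-sub-cube has `2^{N-|R|}` points. -/
theorem card_subcube (R : Finset (Fin N)) (w : Fin N → Bool) :
    (univ.filter fun x : Fin N → Bool => ∀ i ∈ R, x i = w i).card = 2 ^ (N - R.card) := by
  have h := card_filter_subcube R w (fun _ => True) (fun _ _ _ _ _ => trivial)
  rw [Finset.filter_true_of_mem (fun _ _ => trivial), Finset.card_univ] at h
  have h' : (univ.filter fun x : Fin N → Bool => (∀ i ∈ R, x i = w i) ∧ True) =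
      univ.filter fun x : Fin N → Bool => ∀ i ∈ R, x i = w i := by
    ext x; simp
  rw [h'] at h
  have hN : (2 : ℕ) ^ N = 2 ^ R.card * 2 ^ (N - R.card) := by
    rw [← pow_add]; congr 1
    have : R.card ≤ N := le_trans (Finset.card_le_univ R) (by simp)
    omega
  have hc : Fintype.card (Fin N → Bool) = 2 ^ N := by simp
  rw [hc, hN] at h
  exact (Nat.eq_of_mul_eq_mul_left (Nat.two_pow_pos _) h).symm

/-- a parity condition on a non-empty `T` disjoint from `R` HALVES the `R`-sub-cube. -/
theorem card_subcube_par {R T : Finset (Fin N)} (hTR : Disjoint T R) (hT : T.Nonempty) (w : Fin N → Bool) (b : Bool) :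
    2 * (univ.filter fun x : Fin N → Bool => (∀ i ∈ R, x i = w i) ∧ parB T x = b).card = 2 ^ (N - R.card) := by
  obtain ⟨i₀, hi₀⟩ := hT
  have hi₀R : i₀ ∉ R := fun h => Finset.disjoint_left.1 hTR hi₀ h
  have hflip : ∀ b : Bool, (univ.filter fun x : Fin N → Bool => (∀ i ∈ R, x i = w i) ∧ parB T x = b).card =
      (univ.filter fun x : Fin N → Bool => (∀ i ∈ R, x i = w i) ∧ parB T x = !b).card := by
    intro b
    refine Finset.card_bij' (fun x _ => Function.update x i₀ (!x i₀)) (fun x _ => Function.update x i₀ (!x i₀))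
      ?_ ?_ ?_ ?_
    · intro x hx
      rw [mem_filter] at hx ⊢
      refine ⟨mem_univ _, fun i hi => ?_, by rw [parB_update_flip hi₀, hx.2.2]⟩
      rw [Function.update_apply, if_neg (by rintro rfl; exact hi₀R hi)]; exact hx.2.1 i hi
    · intro x hx
      rw [mem_filter] at hx ⊢
      refine ⟨mem_univ _, fun i hi => ?_, by rw [parB_update_flip hi₀, hx.2.2]; cases b <;> rfl⟩
      rw [Function.update_apply, if_neg (by rintro rfl; exact hi₀R hi)]; exact hx.2.1 i hi
    · intro x _
      rw [Function.update_idem, Function.update_self, Bool.not_not, Function.update_eq_self]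
    · intro x _
      rw [Function.update_idem, Function.update_self, Bool.not_not, Function.update_eq_self]
  have hsplit := Finset.card_filter_add_card_filter_not
    (s := univ.filter fun x : Fin N → Bool => ∀ i ∈ R, x i = w i) (fun x => parB T x = b)
  rw [Finset.filter_filter, Finset.filter_filter, card_subcube] at hsplit
  have hneg : (univ.filter fun x : Fin N → Bool => (∀ i ∈ R, x i = w i) ∧ ¬ parB T x = b).card =
      (univ.filter fun x : Fin N → Bool => (∀ i ∈ R, x i = w i) ∧ parB T x = !b).card := by
    congr 1; ext x; simp only [mem_filter, mem_univ, true_and]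
    exact and_congr_right fun _ => by cases b <;> cases h : parB T x <;> simp
  rw [hneg, ← hflip b] at hsplit
  omega

/-- **RESTRICTED SMOLENSKY** (`paritySubset_agreement_le` on an `R`-sub-cube, via `comp_subst_mem_lowDeg` + homogeneity). -/
theorem smolensky_restrict (T R : Finset (Fin N)) (hTR : Disjoint T R) (w : Fin N → Bool) {D : ℕ}
    {Q : CubeFn (ZMod 3) N} (hQ : Q ∈ lowDeg (ZMod 3) N D) :
    (univ.filter fun x : Fin N → Bool => (∀ i ∈ R, x i = w i) ∧
        Q x = if (T.filter fun i => x i = true).card % 2 = 1 then 1 else 0).card ≤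
      2 ^ (N - T.card - R.card) * (2 ^ (T.card - 1) + D * T.card.choose (T.card / 2)) := by
  set mrg : (Fin N → Bool) → (Fin N → Bool) := fun x i => if i ∈ R then w i else x i with hmrg
  have hQ' : (fun x => Q (mrg x)) ∈ lowDeg (ZMod 3) N D := by
    refine comp_subst_mem_lowDeg mrg (fun i => ?_) hQ
    by_cases hi : i ∈ R
    · exact Or.inl ⟨w i, fun x => if_pos hi⟩
    · exact Or.inr ⟨i, fun x => if_neg hi⟩
  have hglob := paritySubset_agreement_le T (F := ZMod 3) (by decide) hQ'
  have hM := card_filter_subcube R w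
    (fun x => Q (mrg x) = if (T.filter fun i => x i = true).card % 2 = 1 then 1 else 0) ?_
  · have hset : (univ.filter fun x : Fin N → Bool => (∀ i ∈ R, x i = w i) ∧
        Q x = if (T.filter fun i => x i = true).card % 2 = 1 then 1 else 0) =
        (univ.filter fun x : Fin N → Bool => (∀ i ∈ R, x i = w i) ∧
          Q (mrg x) = if (T.filter fun i => x i = true).card % 2 = 1 then 1 else 0) := by
      refine Finset.filter_congr fun x _ => ?_
      have key : (∀ i ∈ R, x i = w i) → mrg x = x := fun h => funext fun i => by
        by_cases hi : i ∈ R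
        · rw [hmrg]; simp only; rw [if_pos hi, h i hi]
        · rw [hmrg]; simp only; rw [if_neg hi]
      constructor
      · rintro ⟨h1, h2⟩; exact ⟨h1, by rwa [key h1]⟩
      · rintro ⟨h1, h2⟩; exact ⟨h1, by rwa [key h1] at h2⟩
    rw [hset]
    have hTc : Tᶜ.card = N - T.card := by rw [Finset.card_compl, Fintype.card_fin]
    have hRle : R.card ≤ N - T.card := by
      rw [← hTc]; exact Finset.card_le_card fun i hi => Finset.mem_compl.2 fun hiT => Finset.disjoint_left.1 hTR hiT hi
    have h2 : 2 ^ Tᶜ.card = 2 ^ R.card * 2 ^ (N - T.card - R.card) := by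
      rw [← pow_add, hTc]; congr 1; omega
    have hglob' : 2 ^ R.card * (univ.filter fun x : Fin N → Bool => (∀ i ∈ R, x i = w i) ∧
        Q (mrg x) = if (T.filter fun i => x i = true).card % 2 = 1 then 1 else 0).card ≤
        2 ^ Tᶜ.card * (2 ^ (T.card - 1) + D * T.card.choose (T.card / 2)) := by
      rw [← hM]; convert hglob using 3
    rw [h2, mul_assoc] at hglob'
    exact Nat.le_of_mul_le_mul_left hglob' (Nat.two_pow_pos _)
  · intro x i b hi h
    have h1 : mrg (Function.update x i b) = mrg x := funext fun j => by
      by_cases hj : j ∈ R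
      · rw [hmrg]; simp only; rw [if_pos hj, if_pos hj]
      · rw [hmrg]; simp only; rw [if_neg hj, if_neg hj, Function.update_apply, if_neg (by rintro rfl; exact hj hi)]
    have h2 : ((T.filter fun j => Function.update x i b j = true)) = T.filter fun j => x j = true :=
      Finset.filter_congr fun j hj => by
        rw [Function.update_apply, if_neg (by rintro rfl; exact Finset.disjoint_left.1 hTR hj hi)]
    rw [h1, h2]; exact h

/-- the indicator polynomial of `[Q = ι p]`: `selP Q` for `p = 1`, `1 − Q²` for `p = 0` (degree doubles). -/
def indP (Q : CubeFn (ZMod 3) N) (p : Bool) : CubeFn (ZMod 3) N := if p then selP Q else 1 - Q * Q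
/-- StabilizerDialAntipodal helper `indP_mem` (antipodal certificate; see the module docstring). -/
theorem indP_mem {D : ℕ} {Q : CubeFn (ZMod 3) N} (hQ : Q ∈ lowDeg (ZMod 3) N D) (p : Bool) :
    indP Q p ∈ lowDeg (ZMod 3) N (D + D) := by
  unfold indP; split_ifs
  · exact selP_mem hQ
  · exact Submodule.sub_mem _ (one_mem_lowDeg _) (mul_mem_lowDeg_add hQ hQ)
/-- StabilizerDialAntipodal helper `indP_apply` (antipodal certificate; see the module docstring). -/
theorem indP_apply (Q : CubeFn (ZMod 3) N) (p : Bool) (x : Fin N → Bool) :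
    indP Q p x = if Q x = (if p then 1 else 0) then 1 else 0 := by
  unfold indP
  cases p
  · simp only [Bool.false_eq_true, if_false, Pi.sub_apply, Pi.mul_apply, Pi.one_apply]
    generalize Q x = q; revert q; decide
  · simp only [if_true]; exact selP_apply Q x
/-- StabilizerDialAntipodal helper `indP_bool` (antipodal certificate; see the module docstring). -/
theorem indP_bool (Q : CubeFn (ZMod 3) N) (p : Bool) (x : Fin N → Bool) : indP Q p x = 0 ∨ indP Q p x = 1 := by
  rw [indP_apply]
  by_cases h : Q x = (if p then 1 else 0)
  · rw [if_pos h]; exact Or.inr rfl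
  · rw [if_neg h]; exact Or.inl rfl
/-- **S2 (odd-slice Smolensky) — PROVED.**  `2·count = (count + count') + (count − count')`: the first bracket is a plain
restricted Smolensky count in the `T`-coordinates; the second is summed over the `2^{|T|}` sub-cubes with `T` frozen, on each of
which it equals `agree(indicator, parity of T') − 2^{|T'|-1} ≤ 2D·C(|T'|, |T'|/2)` (restricted Smolensky for the degree-`2D` indicator). -/
theorem oddSliceBound_holds (N : ℕ) : OddSliceBound N := by
  intro D hD T T' hTT Q hQ w c
  -- normal form of the restriction
  set R : Finset (Fin N) := (T ∪ T')ᶜ with hRdef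
  have hRiff : ∀ x : Fin N → Bool, (∀ i, i ∉ T → i ∉ T' → x i = w i) ↔ ∀ i ∈ R, x i = w i := by
    intro x
    simp only [hRdef, Finset.mem_compl, Finset.mem_union, not_or]
    exact ⟨fun h i hi => h i hi.1 hi.2, fun h i h1 h2 => h i ⟨h1, h2⟩⟩
  have hTR : Disjoint T R := Finset.disjoint_left.2 fun i hi hiR => by
    rw [hRdef, Finset.mem_compl, Finset.mem_union] at hiR; exact hiR (Or.inl hi)
  have hRcard : R.card = N - T.card - T'.card := by
    rw [hRdef, Finset.card_compl, Fintype.card_fin, Finset.card_union_of_disjoint hTT]; omega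
  have hk : T.card + T'.card ≤ N := by
    have := Finset.card_le_univ (T ∪ T'); rw [Finset.card_union_of_disjoint hTT, Fintype.card_fin] at this; exact this
  set m₁ := T.card with hm₁
  set m₂ := T'.card with hm₂
  -- the slice set and its mirror
  set cnt : Bool → ℕ := fun c' => (univ.filter fun x : Fin N → Bool =>
    (∀ i ∈ R, x i = w i) ∧ parB (T ∪ T') x = c' ∧ Q x = if parB T x then 1 else 0).card with hcnt
  have hgoal : (univ.filter fun x : Fin N → Bool => (∀ i, i ∉ T → i ∉ T' → x i = w i) ∧
      parB (T ∪ T') x = c ∧ Q x = if parB T x then 1 else 0).card = cnt c := by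
    simp only [hcnt]; congr 1; ext x; simp only [mem_filter, mem_univ, true_and, hRiff]
  rw [hgoal]
  -- degenerate case `T' = ∅`
  rcases T'.eq_empty_or_nonempty with hT'0 | hT'ne
  · have hle : cnt c ≤ 2 ^ (N - R.card) := by
      rw [← card_subcube R w]
      exact Finset.card_le_card (fun x hx => by rw [mem_filter] at hx ⊢; exact ⟨hx.1, hx.2.1⟩)
    have hm20 : m₂ = 0 := by rw [hm₂, hT'0, Finset.card_empty]
    rw [hm20]
    have : N - R.card = m₁ := by rw [hRcard]; omega
    rw [this] at hle
    calc cnt c ≤ 2 ^ m₁ := hle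
      _ ≤ 2 * D * (Nat.choose 0 (0 / 2)) * 2 ^ m₁ := by rw [Nat.choose_zero_right]; nlinarith [Nat.two_pow_pos m₁]
      _ ≤ _ := Nat.le_add_left _ _
  -- degenerate case `T = ∅`
  rcases T.eq_empty_or_nonempty with hT0 | hTne
  · have hle : cnt c ≤ 2 ^ (N - R.card) := by
      rw [← card_subcube R w]
      exact Finset.card_le_card (fun x hx => by rw [mem_filter] at hx ⊢; exact ⟨hx.1, hx.2.1⟩)
    have hm10 : m₁ = 0 := by rw [hm₁, hT0, Finset.card_empty]
    rw [hm10]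
    have : N - R.card = m₂ := by rw [hRcard]; omega
    rw [this] at hle
    calc cnt c ≤ 2 ^ m₂ := hle
      _ ≤ D * (Nat.choose 0 (0 / 2)) * 2 ^ m₂ := by rw [Nat.choose_zero_right]; nlinarith [Nat.two_pow_pos m₂]
      _ ≤ 2 ^ (0 + m₂ - 2) + D * (Nat.choose 0 (0 / 2)) * 2 ^ m₂ := Nat.le_add_left _ _
      _ ≤ _ := Nat.le_add_right _ _
  have hm1pos : 1 ≤ m₁ := by rw [hm₁]; exact Finset.card_pos.2 hTne
  -- (1) count + count' = plain restricted agreement ≤ 2^{m₂} (2^{m₁-1} + D C₁)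
  have h1 : cnt c + cnt (!c) ≤ 2 ^ m₂ * (2 ^ (m₁ - 1) + D * m₁.choose (m₁ / 2)) := by
    have hA := smolensky_restrict T R hTR w hQ
    rw [show N - T.card - R.card = m₂ by rw [hRcard]; omega] at hA
    refine le_trans (le_of_eq ?_) hA
    rw [hcnt]; simp only
    rw [← Finset.card_union_of_disjoint]
    · congr 1; ext x
      simp only [Finset.mem_union, mem_filter, mem_univ, true_and, ite_parB]
      constructor
      · rintro (⟨h1, -, h3⟩ | ⟨h1, -, h3⟩) <;> exact ⟨h1, h3⟩
      · rintro ⟨h1, h3⟩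
        by_cases hp : parB (T ∪ T') x = c
        · exact Or.inl ⟨h1, hp, h3⟩
        · refine Or.inr ⟨h1, ?_, h3⟩
          revert hp; generalize parB (T ∪ T') x = q; cases q <;> cases c <;> decide
    · rw [Finset.disjoint_left]
      rintro x h1 h2
      rw [mem_filter] at h1 h2
      have := h1.2.2.1; rw [h2.2.2.1] at this; revert this; cases c <;> decide
  -- (2) count ≤ count' + 2^{m₁} · 2D C₂ : fibre over the `2^{m₁}` patterns on `T`
  have h2 : cnt c ≤ cnt (!c) + 2 ^ m₁ * (2 * D * m₂.choose (m₂ / 2)) := by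
    -- patterns: `z` agrees with `w'` off `T`, where `w' = w` on `R` and `false` on `T'`
    set w' : Fin N → Bool := fun i => if i ∈ R then w i else false with hw'
    set Z : Finset (Fin N → Bool) := univ.filter fun z => ∀ i ∈ Tᶜ, z i = w' i with hZ
    have hZcard : Z.card = 2 ^ m₁ := by
      rw [hZ, card_subcube, Finset.card_compl, Fintype.card_fin]; congr 1; omega
    set proj : (Fin N → Bool) → (Fin N → Bool) := fun x i => if i ∈ T then x i else w' i with hproj
    have hprojZ : ∀ x, proj x ∈ Z := fun x => by
      rw [hZ, mem_filter]; refine ⟨mem_univ _, fun i hi => ?_⟩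
      rw [Finset.mem_compl] at hi; rw [hproj]; simp only; rw [if_neg hi]
    -- per-pattern sets (restriction set `T'ᶜ = R ∪ T`)
    set fib : Bool → (Fin N → Bool) → ℕ := fun c' z => (univ.filter fun x : Fin N → Bool =>
      (∀ i ∈ T'ᶜ, x i = z i) ∧ parB (T ∪ T') x = c' ∧ Q x = if parB T x then 1 else 0).card with hfib
    have hdecomp : ∀ c' : Bool, cnt c' = ∑ z ∈ Z, fib c' z := by
      intro c'
      rw [hcnt]; simp only
      rw [Finset.card_eq_sum_card_fiberwise (f := proj) (t := Z) (fun x _ => hprojZ x)]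
      refine Finset.sum_congr rfl fun z hz => ?_
      rw [hZ, mem_filter] at hz
      rw [hfib]; simp only
      congr 1; ext x
      simp only [mem_filter, mem_univ, true_and]
      constructor
      · rintro ⟨⟨h1, h2, h3⟩, h4⟩
        refine ⟨fun i hi => ?_, h2, h3⟩
        rw [Finset.mem_compl] at hi
        by_cases hiT : i ∈ T
        · have := congrFun h4 i; rw [hproj] at this; simp only at this; rwa [if_pos hiT] at this
        · have hiR : i ∈ R := by rw [hRdef, Finset.mem_compl, Finset.mem_union, not_or]; exact ⟨hiT, hi⟩
          rw [h1 i hiR, hz.2 i (Finset.mem_compl.2 hiT), hw']; simp only; rw [if_pos hiR]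
      · rintro ⟨h1, h2, h3⟩
        have hR' : ∀ i ∈ R, x i = w i := fun i hiR => by
          have hi : i ∉ T ∧ i ∉ T' := by
            rw [hRdef, Finset.mem_compl, Finset.mem_union, not_or] at hiR; exact hiR
          rw [h1 i (Finset.mem_compl.2 hi.2), hz.2 i (Finset.mem_compl.2 hi.1), hw']; simp only; rw [if_pos hiR]
        refine ⟨⟨hR', h2, h3⟩, funext fun i => ?_⟩
        rw [hproj]; simp only
        by_cases hiT : i ∈ T
        · rw [if_pos hiT, h1 i (Finset.mem_compl.2 (fun hiT' => Finset.disjoint_left.1 hTT hiT hiT'))]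
        · rw [if_neg hiT, hz.2 i (Finset.mem_compl.2 hiT)]
    -- per pattern: fib c z ≤ fib (!c) z + 2 D C₂
    have hper : ∀ z ∈ Z, fib c z ≤ fib (!c) z + 2 * D * m₂.choose (m₂ / 2) := by
      intro z _
      obtain ⟨p, hp⟩ : ∃ p : Bool, parB T z = p := ⟨_, rfl⟩
      obtain ⟨b, hb⟩ : ∃ b : Bool, xor c p = b := ⟨_, rfl⟩
      have hT'c : Disjoint T' T'ᶜ := disjoint_compl_right
      -- on the fibre `parB T x = p`, and the slice condition reads `parB T' x = c ⊕ p`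
      have hfibT : ∀ x : Fin N → Bool, (∀ i ∈ T'ᶜ, x i = z i) → parB T x = p := fun x hx =>
        (parB_congr fun i hi => hx i (Finset.mem_compl.2 fun hiT' => Finset.disjoint_left.1 hTT hi hiT')).trans hp
      have hslice : ∀ (x : Fin N → Bool) (c' : Bool), (∀ i ∈ T'ᶜ, x i = z i) →
          (parB (T ∪ T') x = c' ↔ parB T' x = xor c' p) := fun x c' hx => by
        rw [parB_union hTT, hfibT x hx]
        generalize parB T' x = q; cases q <;> cases c' <;> cases p <;> decide
      -- rewrite both fibre counts with the indicator polynomial `F = indP Q p`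
      set F := indP Q p with hF
      have hFmem : F ∈ lowDeg (ZMod 3) N (D + D) := indP_mem hQ p
      have hFval : ∀ x : Fin N → Bool, (∀ i ∈ T'ᶜ, x i = z i) →
          ((Q x = if parB T x then 1 else 0) ↔ F x = 1) := fun x hx => by
        rw [hfibT x hx, hF, indP_apply]
        by_cases h : Q x = (if p then 1 else 0)
        · rw [if_pos h]; exact ⟨fun _ => rfl, fun _ => h⟩
        · rw [if_neg h]; exact ⟨fun h' => (h h').elim, fun h' => absurd h' (by decide)⟩
      have hfib_eq : ∀ c' : Bool, fib c' z = (univ.filter fun x : Fin N → Bool =>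
          (∀ i ∈ T'ᶜ, x i = z i) ∧ F x = 1 ∧ parB T' x = xor c' p).card := by
        intro c'
        rw [hfib]; simp only; congr 1; ext x; simp only [mem_filter, mem_univ, true_and]
        constructor
        · rintro ⟨h1, h2, h3⟩; exact ⟨h1, (hFval x h1).1 h3, (hslice x c' h1).1 h2⟩
        · rintro ⟨h1, h2, h3⟩; exact ⟨h1, (hslice x c' h1).2 h3, (hFval x h1).2 h2⟩
      rw [hfib_eq, hfib_eq]
      have hxb : xor (!c) p = !b := by rw [← hb]; cases c <;> cases p <;> rfl
      rw [hb, hxb]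
      -- agreement set of `F` with `[parB T' = b]`, and the half-cube `parB T' = !b`
      set Agr := (univ.filter fun x : Fin N → Bool =>
        (∀ i ∈ T'ᶜ, x i = z i) ∧ F x = if (parB T' x = b) then 1 else 0) with hAgr
      set H := (univ.filter fun x : Fin N → Bool => (∀ i ∈ T'ᶜ, x i = z i) ∧ parB T' x = !b) with hH
      have hHcard : 2 * H.card = 2 ^ m₂ := by
        rw [hH, card_subcube_par hT'c hT'ne z (!b), Finset.card_compl, Fintype.card_fin]; congr 1; omega
      -- #Agr = #{F=1, par=b} + (#H − #{F=1, par=!b})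
      have hAgr_split : Agr.card + (univ.filter fun x : Fin N → Bool =>
          (∀ i ∈ T'ᶜ, x i = z i) ∧ F x = 1 ∧ parB T' x = !b).card =
          (univ.filter fun x : Fin N → Bool => (∀ i ∈ T'ᶜ, x i = z i) ∧ F x = 1 ∧ parB T' x = b).card + H.card := by
        -- Agr = S_b ∪ (H \ S_!b') as disjoint pieces
        have hAeq : Agr = (univ.filter fun x : Fin N → Bool => (∀ i ∈ T'ᶜ, x i = z i) ∧ F x = 1 ∧ parB T' x = b) ∪
            (univ.filter fun x : Fin N → Bool => (∀ i ∈ T'ᶜ, x i = z i) ∧ F x = 0 ∧ parB T' x = !b) := by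
          ext x; simp only [hAgr, Finset.mem_union, mem_filter, mem_univ, true_and]
          constructor
          · rintro ⟨h1, h2⟩
            by_cases hpb : parB T' x = b
            · rw [if_pos hpb] at h2; exact Or.inl ⟨h1, h2, hpb⟩
            · rw [if_neg hpb] at h2; refine Or.inr ⟨h1, h2, ?_⟩
              revert hpb; generalize parB T' x = q; cases q <;> cases b <;> decide
          · rintro (⟨h1, h2, h3⟩ | ⟨h1, h2, h3⟩)
            · exact ⟨h1, by rw [if_pos h3, h2]⟩
            · refine ⟨h1, ?_⟩
              have : ¬ parB T' x = b := by rw [h3]; cases b <;> decide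
              rw [if_neg this, h2]
        have hHeq : H = (univ.filter fun x : Fin N → Bool => (∀ i ∈ T'ᶜ, x i = z i) ∧ F x = 1 ∧ parB T' x = !b) ∪
            (univ.filter fun x : Fin N → Bool => (∀ i ∈ T'ᶜ, x i = z i) ∧ F x = 0 ∧ parB T' x = !b) := by
          ext x; simp only [hH, Finset.mem_union, mem_filter, mem_univ, true_and]
          constructor
          · rintro ⟨h1, h2⟩
            rcases indP_bool Q p x with h0 | h0
            · exact Or.inr ⟨h1, h0, h2⟩
            · exact Or.inl ⟨h1, h0, h2⟩
          · rintro (⟨h1, -, h3⟩ | ⟨h1, -, h3⟩) <;> exact ⟨h1, h3⟩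
        have hd1 : Disjoint (univ.filter fun x : Fin N → Bool => (∀ i ∈ T'ᶜ, x i = z i) ∧ F x = 1 ∧ parB T' x = b)
            (univ.filter fun x : Fin N → Bool => (∀ i ∈ T'ᶜ, x i = z i) ∧ F x = 0 ∧ parB T' x = !b) := by
          rw [Finset.disjoint_left]; intro x h1 h2; rw [mem_filter] at h1 h2
          have := h1.2.2.1; rw [h2.2.2.1] at this; revert this; decide
        have hd2 : Disjoint (univ.filter fun x : Fin N → Bool => (∀ i ∈ T'ᶜ, x i = z i) ∧ F x = 1 ∧ parB T' x = !b)
            (univ.filter fun x : Fin N → Bool => (∀ i ∈ T'ᶜ, x i = z i) ∧ F x = 0 ∧ parB T' x = !b) := by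
          rw [Finset.disjoint_left]; intro x h1 h2; rw [mem_filter] at h1 h2
          have := h1.2.2.1; rw [h2.2.2.1] at this; revert this; decide
        rw [hAeq, hHeq, Finset.card_union_of_disjoint hd1, Finset.card_union_of_disjoint hd2]; ring
      -- Smolensky bound on #Agr (for `b = false` pass to `1 - F`)
      have hAgr_le : Agr.card ≤ 2 ^ (m₂ - 1) + 2 * D * m₂.choose (m₂ / 2) := by
        have hexp : N - T'.card - T'ᶜ.card = 0 := by rw [Finset.card_compl, Fintype.card_fin]; omega
        cases b
        · -- F x = ι(¬par) ⟺ (1 - F) x = ι(par)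
          have hS := smolensky_restrict T' T'ᶜ hT'c z (D := D + D) (Q := 1 - F)
            (Submodule.sub_mem _ (one_mem_lowDeg _) hFmem)
          rw [hexp, pow_zero, one_mul, ← two_mul, ← hm₂] at hS
          refine le_trans (le_of_eq ?_) hS
          rw [hAgr]; congr 1; ext x; simp only [mem_filter, mem_univ, true_and, Pi.sub_apply, Pi.one_apply]
          refine and_congr_right fun _ => ?_
          by_cases hP : (T'.filter fun i => x i = true).card % 2 = 1
          · have hpb : parB T' x = true := by unfold parB; exact decide_eq_true hP
            rw [hpb, if_pos hP]
            rcases indP_bool Q p x with h0 | h0 <;> rw [← hF] at h0 <;> rw [h0] <;> decide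
          · have hpb : parB T' x = false := by unfold parB; exact decide_eq_false hP
            rw [hpb, if_neg hP]
            rcases indP_bool Q p x with h0 | h0 <;> rw [← hF] at h0 <;> rw [h0] <;> decide
        · have hS := smolensky_restrict T' T'ᶜ hT'c z (D := D + D) (Q := F) hFmem
          rw [hexp, pow_zero, one_mul, ← two_mul, ← hm₂] at hS
          refine le_trans (le_of_eq ?_) hS
          rw [hAgr]; congr 1; ext x; simp only [mem_filter, mem_univ, true_and]
          refine and_congr_right fun _ => ?_
          by_cases hP : (T'.filter fun i => x i = true).card % 2 = 1
          · have hpb : parB T' x = true := by unfold parB; exact decide_eq_true hP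
            rw [hpb, if_pos hP]
            rcases indP_bool Q p x with h0 | h0 <;> rw [← hF] at h0 <;> rw [h0] <;> decide
          · have hpb : parB T' x = false := by unfold parB; exact decide_eq_false hP
            rw [hpb, if_neg hP]
            rcases indP_bool Q p x with h0 | h0 <;> rw [← hF] at h0 <;> rw [h0] <;> decide
      have hm2pos : 1 ≤ m₂ := by rw [hm₂]; exact Finset.card_pos.2 hT'ne
      have h2pow : 2 ^ m₂ = 2 * 2 ^ (m₂ - 1) := by
        rw [← pow_succ']; congr 1; omega
      omega
    -- sum over the patterns
    rw [hdecomp c, hdecomp (!c)]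
    calc ∑ z ∈ Z, fib c z ≤ ∑ z ∈ Z, (fib (!c) z + 2 * D * m₂.choose (m₂ / 2)) := Finset.sum_le_sum hper
      _ = ∑ z ∈ Z, fib (!c) z + 2 ^ m₁ * (2 * D * m₂.choose (m₂ / 2)) := by
        rw [Finset.sum_add_distrib, Finset.sum_const, smul_eq_mul, hZcard]
  -- (3) combine: 2·count ≤ (count + count') + 2^{m₁}·2DC₂
  have hm2pos : 1 ≤ m₂ := by rw [hm₂]; exact Finset.card_pos.2 hT'ne
  have hpow : 2 ^ m₂ * 2 ^ (m₁ - 1) ≤ 2 * 2 ^ (m₁ + m₂ - 2) := by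
    rw [← pow_add, ← pow_succ']
    exact Nat.pow_le_pow_right (by norm_num) (by omega)
  rw [mul_add] at h1
  have e1 : D * m₁.choose (m₁ / 2) * 2 ^ m₂ = 2 ^ m₂ * (D * m₁.choose (m₁ / 2)) := by ring
  have e2 : 2 * D * m₂.choose (m₂ / 2) * 2 ^ m₁ = 2 ^ m₁ * (2 * D * m₂.choose (m₂ / 2)) := by ring
  rw [e1, e2]
  omega



end Summit.QuantumAdvantage.QuantumAdvantage.Theorems.StabilizerDial
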